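import Literature.NumberTheory.Automorphic.TorusIntegrandThinSupport
import Literature.NumberTheory.Automorphic.ArchRankinSelbergBridge
import Literature.NumberTheory.Automorphic.CuspidalEigenTestVector

/-!
# The thin test function at a torus point, and the level of the partner's smoothed vector

Summit `Langlands`, sub-problem `Langlands`, helper file under `Theorems/` supporting the crux
`PairLBoundaryJS` (stmt-Langlands-13622, Arthur–Clozel (1989), Ch. 3, (2.2)), line `Sketch`,
registered stub `stub_hloc_ne_gen` (finite-place half: the thin Rankin–Selberg torus pair integral,
recon rows (3)(c) and L9).

Two pieces of bookkeeping for the torus pair integral `∫_{B({v ∉ T}) × K} W (star W') Φ |det|^s δ_B⁻¹`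
with the THIN test function `Φ = thinTestFun n K Φ_∞ T m = Φ_∞ ⊗ ⊗_{v ∈ T} 𝟙_{e_n + 𝔭_v^m 𝒪_vⁿ} ⊗ 𝟙_{𝒪̂ⁿ}`
(`Literature.NumberTheory.Automorphic.ThinTestFunction`):

* `ThinLastRowTorusPoint.thinTestFun_lastRow_torusPoint_eq` (**main**) — the thin analogue of the tree theorem
  `Literature.NumberTheory.Automorphic.standardTestFun_lastRow_torusPoint_eq` (`ArchWhittakerTranslate`): at a
  torus point `diag(a) k` all of whose torus coordinates are units at every finite place (`a ∈ unitBox univ`),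
  `Φ(e_n diag(a) k) = Φ_∞(archLastRow ((diag(a) k)_∞)) · 𝟙[∀ v ∈ T, e_n (diag(a) k)_v ≡ e_n (mod 𝔭_v^m)]`.
  What changed w.r.t. the standard theorem: the finite factor `𝟙_{𝒪̂ⁿ}` (which is `1` on the unit
  box) is replaced by the thin indicator, whose value on the unit box is the indicator of the
  congruence `|(e_n g)_{v,j} - δ_{j,n}|_v ≤ exp(-m)` (`v ∈ T`); the congruence is stated on the
  `v`-components of the last row (`thinTestFun_lastRow_torusPoint_eq`, every rank) and on the last
  row of the local component `(diag(a) k)_v ∈ GL_{n+1}(K_v)` (`thinTestFun_lastRow_torusPoint_succ_eq`,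
  rank `n + 1`), together with the two one-sided forms (`…_eq_of_forall`, `thinTestFun_eq_zero_of_not`).
* `ThinLastRowTorusPoint.whittakerCoeff_smoothedForm_mul_of_mem_principalCongruenceLevel` and its
  specialisations to the pure tensor weight `η = β ⊗ 𝟙_{K_f(𝔫)}` (`archLevelWeight`) — the level of
  the PARTNER: for a vector `f'` of a closed subrepresentation `Π' ≤ L²` fixed by the principal
  congruence subgroup `K(𝔫')` and a test function `η` invariant under conjugation by
  `K^max = (1, GL_n(𝒪̂_K))` (e.g. `β ⊗ 𝟙_{K_f(𝔫)}`, ANY `𝔫`: `K_f(𝔫)` is normal in `GL_n(𝒪̂_K)`),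
  the smoothed vector `S_η f'` is again fixed by `K(𝔫')` (Bump (1997), Prop. 2.3.1:
  `R(k) R(η) = R(η) R(k)`, tree `toContRep_smoothedVector_comm`), hence its continuous representative
  and its global Whittaker coefficient are right invariant under `K(𝔫') ⊇ (1, K_f(𝔫')) ⊇ ι_v(K_v(𝔭_v^{ord_v 𝔫'}))`.

All proofs complete; tree theorems only.

## References

* H. Jacquet, I. I. Piatetski-Shapiro, J. A. Shalika, *Rankin–Selberg convolutions*, Amer. J. Math.
  105 (1983), §2, (2.7) [JacquetPiatetskiShapiroShalika1983].
* D. Bump, *Automorphic Forms and Representations* (1997), Prop. 2.3.1, §3.3 [Bump1997].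
* J. W. Cogdell, *Analytic theory of L-functions for GL_n* (2004), §1.2, §2.3 [CogdellAnalyticTheory2004].
-/

noncomputable section

-- `Summit.Langlands.Langlands.…` (summit = sub-problem name, D-0017 layout) trips `dupNamespace`
set_option linter.dupNamespace false

open scoped MatrixGroups Topology Pointwise ENNReal NNReal ComplexConjugate InnerProductSpace
open NumberField IsDedekindDomain MeasureTheory Measure Matrix Set Filter
open Literature.NumberTheory.Automorphic AdelicGroupData
open Literature.NumberTheory.GaloisRepresentations (ideleGroup)
open ValuativeRel

-- the automorphic quotient carries the tree's Borel σ-algebra, not Mathlib's quotient σ-algebra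
attribute [-instance] Quotient.instMeasurableSpace QuotientGroup.measurableSpace

-- the house local instances, exactly as in `RankinSelbergUnfoldingIdentity`
attribute [local instance] adelicBorel borelSpace_adelic locallyCompactSpace_adelic secondCountableTopology_gl_adelic
  glAdeleBorel borelSpace_glAdele borelSpace_ideleGroup secondCountableTopology_ideleGroup

namespace Summit.Langlands.Langlands.Theorems.ThinLastRowTorusPoint

/-! ### The thin test function at a torus point -/

section Thin

variable {n : ℕ} {K : Type} [Field K] [NumberField K]

/-- **At `v`, the last row of `g ∈ GL_{n+1}(𝔸_K)` is the last row of its `v`-component**: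
`(e_{n+1} g)_{j,v} = (g_v)_{n,j}`. [folklore] -/
theorem lastRow_succ_apply_adicComponent (v : HeightOneSpectrum (𝓞 K))
    (g : GL (Fin (n + 1)) (AdeleRing (𝓞 K) K)) (j : Fin (n + 1)) :
    (lastRow (n + 1) K g j).2 v =
      ((localComponent v g : GL (Fin (n + 1)) (v.adicCompletion K)) :
        Matrix (Fin (n + 1)) (Fin (n + 1)) (v.adicCompletion K)) (Fin.last n) j := by
  rw [lastRow_succ_apply]
  rfl

/-- **Off the thin box the thin test function vanishes**: if the congruence `|y_{j,v} - δ_{j,n-1}|_v ≤ exp(-m)`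
fails for some `v ∈ T` and some `j`, then `Φ(y) = 0` (no integrality hypothesis needed). [folklore] -/
theorem thinTestFun_eq_zero_of_not :
    ∀ {n : ℕ} {K : Type} [Field K] [NumberField K]
      (Φinf : (Fin n → InfiniteAdeleRing K) → ℝ) {T : Finset (HeightOneSpectrum (𝓞 K))} {m : ℕ}
      (y : Fin n → AdeleRing (𝓞 K) K),
      (¬ ∀ v ∈ T, ∀ j : Fin n,
          Valued.v ((y j).2 v - if (j : ℕ) + 1 = n then 1 else 0) ≤ WithZero.exp (-(m : ℤ))) →
      thinTestFun n K Φinf T m y = 0 := by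
  intro n K _ _ Φinf T m y hc
  unfold thinTestFun
  rw [if_neg (fun h : _ ∈ thinFiniteBox n K T m => hc h.2)]

/-- **The thin test function at a torus point of the unit box** (the thin analogue of
`standardTestFun_lastRow_torusPoint_eq`). For `a ∈ (𝔸_Kˣ)ⁿ` with `|a_{i,w}|_w = 1` at every finite
place `w` and `k ∈ K = K_∞ GL_n(𝒪̂_K)`, the last row `e_n diag(a) k` is integral at every finite
place (`valued_lastRow_torusPoint_le_one`), so
`thinTestFun n K Φ_∞ T m (e_n diag(a) k) = Φ_∞(archLastRow ((diag(a) k)_∞))` if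
`|(e_n diag(a) k)_{j,v} - δ_{j,n-1}|_v ≤ exp(-m)` for all `v ∈ T`, `j`, and `= 0` otherwise.
[folklore] -/
theorem thinTestFun_lastRow_torusPoint_eq :
    ∀ {n : ℕ} {K : Type} [Field K] [NumberField K]
      (Φinf : (Fin n → InfiniteAdeleRing K) → ℝ) (T : Finset (HeightOneSpectrum (𝓞 K))) (m : ℕ)
      {a : Fin n → ideleGroup K},
      a ∈ (unitBox (Set.univ : Set (HeightOneSpectrum (𝓞 K))) : Set (Fin n → ideleGroup K)) →
      ∀ k : ↥(maximalCompactAdelic n K),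
      thinTestFun n K Φinf T m (lastRow n K (torusPoint n K (a, k))) =
        if ∀ v ∈ T, ∀ j : Fin n,
            Valued.v ((lastRow n K (torusPoint n K (a, k)) j).2 v - if (j : ℕ) + 1 = n then 1 else 0) ≤
              WithZero.exp (-(m : ℤ))
        then Φinf (archLastRow n K (GLn.toMixed n K (torusPoint n K (a, k)))) else 0 := by
  intro n K _ _ Φinf T m a ha k
  have hint : ∀ (i : Fin n) (w : HeightOneSpectrum (𝓞 K)),
      (lastRow n K (torusPoint n K (a, k)) i).2 w ∈ w.adicCompletionIntegers K := fun i w =>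
    (HeightOneSpectrum.mem_adicCompletionIntegers (R := 𝓞 K) K w).2
      (valued_lastRow_torusPoint_le_one (v := w) (fun j => ha w (Set.mem_univ w) j) k i)
  rw [archLastRow_toMixed]
  unfold thinTestFun
  by_cases hc : ∀ v ∈ T, ∀ j : Fin n,
      Valued.v ((lastRow n K (torusPoint n K (a, k)) j).2 v - if (j : ℕ) + 1 = n then 1 else 0) ≤
        WithZero.exp (-(m : ℤ))
  · rw [if_pos hc, if_pos (show _ ∈ thinFiniteBox n K T m from ⟨hint, hc⟩)]
  · rw [if_neg hc, if_neg (fun h : _ ∈ thinFiniteBox n K T m => hc h.2)]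

/-- **On the thin shell the thin test function is its archimedean factor**: under the congruence
`|(e_n diag(a) k)_{j,v} - δ_{j,n-1}|_v ≤ exp(-m)` (`v ∈ T`) and for `a` in the unit box at all
finite places, `Φ(e_n diag(a) k) = Φ_∞(archLastRow ((diag(a) k)_∞))`. [folklore] -/
theorem thinTestFun_lastRow_torusPoint_eq_of_forall :
    ∀ {n : ℕ} {K : Type} [Field K] [NumberField K]
      (Φinf : (Fin n → InfiniteAdeleRing K) → ℝ) {T : Finset (HeightOneSpectrum (𝓞 K))} {m : ℕ}
      {a : Fin n → ideleGroup K},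
      a ∈ (unitBox (Set.univ : Set (HeightOneSpectrum (𝓞 K))) : Set (Fin n → ideleGroup K)) →
      ∀ k : ↥(maximalCompactAdelic n K),
      (∀ v ∈ T, ∀ j : Fin n,
          Valued.v ((lastRow n K (torusPoint n K (a, k)) j).2 v - if (j : ℕ) + 1 = n then 1 else 0) ≤
            WithZero.exp (-(m : ℤ))) →
      thinTestFun n K Φinf T m (lastRow n K (torusPoint n K (a, k))) =
        Φinf (archLastRow n K (GLn.toMixed n K (torusPoint n K (a, k)))) := by
  intro n K _ _ Φinf T m a ha k hc
  rw [thinTestFun_lastRow_torusPoint_eq Φinf T m ha k, if_pos hc]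

/-- **Rank `n + 1`, local-component form.** For `a` in the unit box at all finite places and
`k ∈ K`, with `g = diag(a) k ∈ GL_{n+1}(𝔸_K)` and `g_v = localComponent v g ∈ GL_{n+1}(K_v)`:
`thinTestFun (n+1) K Φ_∞ T m (e_{n+1} g) = Φ_∞(archLastRow (g_∞))` if the last row of `g_v` is
`≡ e_{n+1} (mod 𝔭_v^m)` for every `v ∈ T` — `|(g_v)_{n,j} - δ_{j,n}|_v ≤ exp(-m)` for all `j` — and
`= 0` otherwise. [folklore] -/
theorem thinTestFun_lastRow_torusPoint_succ_eq :
    ∀ {n : ℕ} {K : Type} [Field K] [NumberField K]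
      (Φinf : (Fin (n + 1) → InfiniteAdeleRing K) → ℝ) (T : Finset (HeightOneSpectrum (𝓞 K))) (m : ℕ)
      {a : Fin (n + 1) → ideleGroup K},
      a ∈ (unitBox (Set.univ : Set (HeightOneSpectrum (𝓞 K))) : Set (Fin (n + 1) → ideleGroup K)) →
      ∀ k : ↥(maximalCompactAdelic (n + 1) K),
      thinTestFun (n + 1) K Φinf T m (lastRow (n + 1) K (torusPoint (n + 1) K (a, k))) =
        if ∀ v ∈ T, ∀ j : Fin (n + 1),
            Valued.v (((localComponent v (torusPoint (n + 1) K (a, k)) : GL (Fin (n + 1)) (v.adicCompletion K)) :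
                Matrix (Fin (n + 1)) (Fin (n + 1)) (v.adicCompletion K)) (Fin.last n) j -
              if j = Fin.last n then 1 else 0) ≤ WithZero.exp (-(m : ℤ))
        then Φinf (archLastRow (n + 1) K (GLn.toMixed (n + 1) K (torusPoint (n + 1) K (a, k)))) else 0 := by
  intro n K _ _ Φinf T m a ha k
  rw [thinTestFun_lastRow_torusPoint_eq Φinf T m ha k]
  have hiff : (∀ v ∈ T, ∀ j : Fin (n + 1),
      Valued.v ((lastRow (n + 1) K (torusPoint (n + 1) K (a, k)) j).2 v - if (j : ℕ) + 1 = n + 1 then 1 else 0) ≤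
        WithZero.exp (-(m : ℤ))) ↔
      ∀ v ∈ T, ∀ j : Fin (n + 1),
        Valued.v (((localComponent v (torusPoint (n + 1) K (a, k)) : GL (Fin (n + 1)) (v.adicCompletion K)) :
            Matrix (Fin (n + 1)) (Fin (n + 1)) (v.adicCompletion K)) (Fin.last n) j -
          if j = Fin.last n then 1 else 0) ≤ WithZero.exp (-(m : ℤ)) := by
    refine forall₂_congr fun v _ => forall_congr' fun j => ?_
    rw [lastRow_succ_apply_adicComponent]
    by_cases hj : j = Fin.last n
    · rw [if_pos hj, if_pos (by rw [hj, Fin.val_last])]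
    · rw [if_neg hj, if_neg (fun h => hj (Fin.ext (by rw [Fin.val_last]; omega)))]
  by_cases hc : ∀ v ∈ T, ∀ j : Fin (n + 1),
      Valued.v ((lastRow (n + 1) K (torusPoint (n + 1) K (a, k)) j).2 v - if (j : ℕ) + 1 = n + 1 then 1 else 0) ≤
        WithZero.exp (-(m : ℤ))
  · rw [if_pos hc, if_pos (hiff.1 hc)]
  · rw [if_neg hc, if_neg (fun h => hc (hiff.2 h))]

/-- **Rank `n + 1`, local-component form, on the thin shell**: if the last row of `(diag(a) k)_v` is
`≡ e_{n+1} (mod 𝔭_v^m)` for every `v ∈ T` and `a` lies in the unit box at all finite places, the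
thin test function at `e_{n+1} diag(a) k` is `Φ_∞(archLastRow ((diag(a) k)_∞))`. [folklore] -/
theorem thinTestFun_lastRow_torusPoint_succ_eq_of_forall :
    ∀ {n : ℕ} {K : Type} [Field K] [NumberField K]
      (Φinf : (Fin (n + 1) → InfiniteAdeleRing K) → ℝ) {T : Finset (HeightOneSpectrum (𝓞 K))} {m : ℕ}
      {a : Fin (n + 1) → ideleGroup K},
      a ∈ (unitBox (Set.univ : Set (HeightOneSpectrum (𝓞 K))) : Set (Fin (n + 1) → ideleGroup K)) →
      ∀ k : ↥(maximalCompactAdelic (n + 1) K),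
      (∀ v ∈ T, ∀ j : Fin (n + 1),
          Valued.v (((localComponent v (torusPoint (n + 1) K (a, k)) : GL (Fin (n + 1)) (v.adicCompletion K)) :
              Matrix (Fin (n + 1)) (Fin (n + 1)) (v.adicCompletion K)) (Fin.last n) j -
            if j = Fin.last n then 1 else 0) ≤ WithZero.exp (-(m : ℤ))) →
      thinTestFun (n + 1) K Φinf T m (lastRow (n + 1) K (torusPoint (n + 1) K (a, k))) =
        Φinf (archLastRow (n + 1) K (GLn.toMixed (n + 1) K (torusPoint (n + 1) K (a, k)))) := by
  intro n K _ _ Φinf T m a ha k hc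
  rw [thinTestFun_lastRow_torusPoint_succ_eq Φinf T m ha k, if_pos hc]

/-- **Rank `n + 1`, local-component form, off the thin shell**: if the last row of `(diag(a) k)_v`
is NOT `≡ e_{n+1} (mod 𝔭_v^m)` for some `v ∈ T`, the thin test function vanishes at
`e_{n+1} diag(a) k` (any `a`, `k`). [folklore] -/
theorem thinTestFun_lastRow_torusPoint_succ_eq_zero :
    ∀ {n : ℕ} {K : Type} [Field K] [NumberField K]
      (Φinf : (Fin (n + 1) → InfiniteAdeleRing K) → ℝ) {T : Finset (HeightOneSpectrum (𝓞 K))} {m : ℕ}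
      (p : (Fin (n + 1) → ideleGroup K) × ↥(maximalCompactAdelic (n + 1) K)),
      (¬ ∀ v ∈ T, ∀ j : Fin (n + 1),
          Valued.v (((localComponent v (torusPoint (n + 1) K p) : GL (Fin (n + 1)) (v.adicCompletion K)) :
              Matrix (Fin (n + 1)) (Fin (n + 1)) (v.adicCompletion K)) (Fin.last n) j -
            if j = Fin.last n then 1 else 0) ≤ WithZero.exp (-(m : ℤ))) →
      thinTestFun (n + 1) K Φinf T m (lastRow (n + 1) K (torusPoint (n + 1) K p)) = 0 := by
  intro n K _ _ Φinf T m p hc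
  refine thinTestFun_eq_zero_of_not Φinf _ fun h => hc fun v hv j => ?_
  have h' := h v hv j
  rw [lastRow_succ_apply_adicComponent] at h'
  by_cases hj : j = Fin.last n
  · rw [if_pos hj]; rwa [if_pos (show (j : ℕ) + 1 = n + 1 by rw [hj, Fin.val_last])] at h'
  · rw [if_neg hj]
    rwa [if_neg (show ¬ ((j : ℕ) + 1 = n + 1) from fun h => hj (Fin.ext (by rw [Fin.val_last]; omega)))] at h'

end Thin

/-! ### The level of the partner's smoothed vector -/

section Level

variable {n : ℕ} {K : Type} [Field K] [NumberField K]
  {μ : Measure (AdelicGroupData.gl n K).automorphicQuotient} [(AdelicGroupData.gl n K).IsAutomorphicMeasure μ]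

/-- **`K_f(𝔫)` is normal in `GL_n(𝒪̂_K)`** (finite-adelic form of the tree's
`inv_mul_mul_mem_principalCongruenceLevel`): `u⁻¹ s u ∈ K_f(𝔫)` for `s ∈ K_f(𝔫)`, `u ∈ GL_n(𝒪̂_K)`. [folklore] -/
theorem inv_mul_mul_mem_finitePrincipalCongruenceLevel {𝔫 : Ideal (𝓞 K)}
    {s u : GL (Fin n) (FiniteAdeleRing (𝓞 K) K)} (hs : s ∈ finitePrincipalCongruenceLevel n K 𝔫)
    (hu : u ∈ glFiniteIntegralLevel n K) : u⁻¹ * s * u ∈ finitePrincipalCongruenceLevel n K 𝔫 := by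
  rw [mem_finitePrincipalCongruenceLevel_iff, map_mul, map_mul, map_inv]
  exact inv_mul_mul_mem_principalCongruenceLevel (mem_finitePrincipalCongruenceLevel_iff.1 hs) hu

/-- **`β ⊗ 𝟙_{K_f(𝔫)}` is invariant under conjugation by `K^max = (1, GL_n(𝒪̂_K))`**: for
`k ∈ K^max`, `(β ⊗ 𝟙_{K_f(𝔫)})(k x k⁻¹) = (β ⊗ 𝟙_{K_f(𝔫)})(x)` (`k_∞ = 1` and `K_f(𝔫)` is normal in
`GL_n(𝒪̂_K)`). [folklore] -/
theorem archLevelWeight_conj_eq_of_mem_glIntegralLevel (𝔫 : Ideal (𝓞 K))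
    (β : GL (Fin n) (mixedEmbedding.mixedSpace K) → ℝ) {k : GL (Fin n) (AdeleRing (𝓞 K) K)}
    (hk : k ∈ glIntegralLevel n K) (x : GL (Fin n) (AdeleRing (𝓞 K) K)) :
    archLevelWeight (finitePrincipalCongruenceLevel n K 𝔫) β (k * x * k⁻¹) =
      archLevelWeight (finitePrincipalCongruenceLevel n K 𝔫) β x := by
  have hkf : GLn.sndHom n K k ∈ glFiniteIntegralLevel n K := (mem_glIntegralLevel_iff.1 hk).1
  have hk1 : GLn.toMixed n K k = 1 := by rw [← GLn.ofFinite_sndHom_of_mem hk, GLn.toMixed_ofFinite]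
  have htm : GLn.toMixed n K (k * x * k⁻¹) = GLn.toMixed n K x := by
    rw [map_mul, map_mul, map_inv, hk1, inv_one, one_mul, mul_one]
  have hiff : GLn.sndHom n K (k * x * k⁻¹) ∈ finitePrincipalCongruenceLevel n K 𝔫 ↔
      GLn.sndHom n K x ∈ finitePrincipalCongruenceLevel n K 𝔫 := by
    rw [map_mul, map_mul, map_inv]
    refine ⟨fun h => ?_, fun h => ?_⟩
    · have h' := inv_mul_mul_mem_finitePrincipalCongruenceLevel h hkf
      rwa [show (GLn.sndHom n K k)⁻¹ * (GLn.sndHom n K k * GLn.sndHom n K x * (GLn.sndHom n K k)⁻¹) *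
          GLn.sndHom n K k = GLn.sndHom n K x by group] at h'
    · simpa only [inv_inv] using inv_mul_mul_mem_finitePrincipalCongruenceLevel h ((glFiniteIntegralLevel n K).inv_mem hkf)
  by_cases hx : GLn.sndHom n K x ∈ finitePrincipalCongruenceLevel n K 𝔫
  · rw [archLevelWeight_of_mem β hx, archLevelWeight_of_mem β (hiff.2 hx), htm]
  · rw [archLevelWeight_of_not_mem β hx, archLevelWeight_of_not_mem β (fun h => hx (hiff.1 h))]

variable (W : ContRepresentation.ClosedSubrep ((AdelicGroupData.gl n K).rightRegular μ))

/-- **A vector fixed by `k` has smoothed vector fixed by `k`, for a weight invariant under conjugation by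
`k`**: `R(k) S_η f = S_η R(k) f = S_η f` (Bump (1997), Prop. 2.3.1, tree `toContRep_smoothedVector_comm`; the
Haar measure of the unimodular `GL_n(𝔸_K)` is right invariant, `isMulRightInvariant_adelicHaar`). [folklore] -/
theorem toContRep_smoothedVector_eq_self {η : GL (Fin n) (AdeleRing (𝓞 K) K) → ℝ} (hηc : Continuous η)
    (hηs : HasCompactSupport η) {k : GL (Fin n) (AdeleRing (𝓞 K) K)}
    (hk : ∀ x : GL (Fin n) (AdeleRing (𝓞 K) K), η (k * x * k⁻¹) = η x) {f : W.toSubmodule}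
    (hfix : W.toContRep k f = f) : W.toContRep k (smoothedVector W η f) = smoothedVector W η f := by
  haveI := isMulRightInvariant_adelicHaar n K (GLn.isMulRightInvariant_of_isHaarMeasure_adelic_holds n K)
  rw [toContRep_smoothedVector_comm W hηc hηs hk f, hfix]

/-- **From the vector to the continuous representative**: if `R(k) S_η f = S_η f` in `L²`, then the
continuous function `φ = invQuot (S_η f)` on `GL_n(𝔸_K)` is right `k`-invariant, `φ(y k) = φ(y)` (both `S_η f`
and `x ↦ S_η f (k⁻¹ • x)` are continuous representatives of the same class, `HasContRep.unique`). [folklore] -/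
theorem invQuot_smoothedForm_mul_of_toContRep_eq {η : GL (Fin n) (AdeleRing (𝓞 K) K) → ℝ} (hηc : Continuous η)
    (hηs : HasCompactSupport η) {k : GL (Fin n) (AdeleRing (𝓞 K) K)} {f : W.toSubmodule}
    (h : W.toContRep k (smoothedVector W η f) = smoothedVector W η f) (y : GL (Fin n) (AdeleRing (𝓞 K) K)) :
    invQuot (AdelicGroupData.gl n K) (smoothedForm η (f : (AdelicGroupData.gl n K).L2 μ)) (y * k) =
      invQuot (AdelicGroupData.gl n K) (smoothedForm η (f : (AdelicGroupData.gl n K).L2 μ)) y := by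
  have hrep := hasContRep_smoothedVector W hηc hηs f
  have hrep' := hrep.toContRep k
  rw [h] at hrep'
  have hfun := hrep'.unique hrep
  refine (invQuot_mul_eq_smul (smoothedForm η (f : (AdelicGroupData.gl n K).L2 μ)) y k).trans ?_
  exact (congrFun hfun _).trans (invQuot_apply _ _ _).symm

/-- **The smoothed vector of a `K(𝔫')`-fixed vector by an `Ad(K^max)`-invariant weight is
`K(𝔫')`-fixed.** [folklore] -/
theorem toContRep_smoothedVector_eq_self_of_mem_principalCongruenceLevel
    {η : GL (Fin n) (AdeleRing (𝓞 K) K) → ℝ} (hηc : Continuous η) (hηs : HasCompactSupport η)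
    (hconj : ∀ k ∈ glIntegralLevel n K, ∀ x : GL (Fin n) (AdeleRing (𝓞 K) K), η (k * x * k⁻¹) = η x)
    {𝔫' : Ideal (𝓞 K)} {f : W.toSubmodule} (hfix : ∀ g ∈ principalCongruenceLevel n K 𝔫', W.toContRep g f = f)
    {g : GL (Fin n) (AdeleRing (𝓞 K) K)} (hg : g ∈ principalCongruenceLevel n K 𝔫') :
    W.toContRep g (smoothedVector W η f) = smoothedVector W η f :=
  toContRep_smoothedVector_eq_self W hηc hηs (hconj g (principalCongruenceLevel_le n K 𝔫' hg)) (hfix g hg)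

/-- **Right `K(𝔫')`-invariance of the Whittaker coefficient of the partner** (main form). Let
`Π' ≤ L²(GL_n(K)\GL_n(𝔸_K))` be a closed subrepresentation, `f' ∈ Π'` fixed by the principal
congruence subgroup `K(𝔫')`, and `η` a continuous compactly supported weight invariant under
conjugation by `K^max = (1, GL_n(𝒪̂_K))`. Then for every measure `ν` and domain `𝓕` on `N_n(𝔸_K)`,
every character `ψ`, every `g ∈ K(𝔫')` and every `y`:
`W_ψ(S_η f')(y g) = W_ψ(S_η f')(y)`. [folklore] -/
theorem whittakerCoeff_smoothedForm_mul_of_mem_principalCongruenceLevel :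
    ∀ {n : ℕ} {K : Type} [Field K] [NumberField K]
      {μ : Measure (AdelicGroupData.gl n K).automorphicQuotient} [(AdelicGroupData.gl n K).IsAutomorphicMeasure μ]
      (W : ContRepresentation.ClosedSubrep ((AdelicGroupData.gl n K).rightRegular μ))
      {η : GL (Fin n) (AdeleRing (𝓞 K) K) → ℝ}, Continuous η → HasCompactSupport η →
      (∀ k ∈ glIntegralLevel n K, ∀ x : GL (Fin n) (AdeleRing (𝓞 K) K), η (k * x * k⁻¹) = η x) →
      ∀ {𝔫' : Ideal (𝓞 K)} (f : W.toSubmodule),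
      (∀ g ∈ principalCongruenceLevel n K 𝔫', W.toContRep g f = f) →
      ∀ (ν : Measure ↥(adelicUnipotent n K)) (𝓕 : Set ↥(adelicUnipotent n K))
        (ψ : AddChar (AdeleRing (𝓞 K) K) Circle) {g : GL (Fin n) (AdeleRing (𝓞 K) K)},
      g ∈ principalCongruenceLevel n K 𝔫' →
      ∀ y : GL (Fin n) (AdeleRing (𝓞 K) K),
      whittakerCoeff ν 𝓕 ψ (invQuot (AdelicGroupData.gl n K) (smoothedForm η (f : (AdelicGroupData.gl n K).L2 μ)))
          (y * g) =
        whittakerCoeff ν 𝓕 ψ (invQuot (AdelicGroupData.gl n K) (smoothedForm η (f : (AdelicGroupData.gl n K).L2 μ))) y := by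
  intro n K _ _ μ _ W η hηc hηs hconj 𝔫' f hfix ν 𝓕 ψ g hg y
  exact whittakerCoeff_mul_of_forall ν 𝓕 ψ
    (fun x => invQuot_smoothedForm_mul_of_toContRep_eq W hηc hηs
      (toContRep_smoothedVector_eq_self_of_mem_principalCongruenceLevel W hηc hηs hconj hfix hg) x) y

/-- **The pure tensor weight: right `(1, K_f(𝔫'))`-invariance.** For `η = β ⊗ 𝟙_{K_f(𝔫)}`
(`archLevelWeight`, ANY level `𝔫`) continuous with compact support (e.g. `IsTestFunctionGL`), and
`f' ∈ Π'` fixed by `K(𝔫')`: `W_ψ(S_η f')(y (1, u)) = W_ψ(S_η f')(y)` for `u ∈ K_f(𝔫')`.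
[folklore] -/
theorem whittakerCoeff_smoothedForm_archLevelWeight_mul_ofFinite :
    ∀ {n : ℕ} {K : Type} [Field K] [NumberField K]
      {μ : Measure (AdelicGroupData.gl n K).automorphicQuotient} [(AdelicGroupData.gl n K).IsAutomorphicMeasure μ]
      (W : ContRepresentation.ClosedSubrep ((AdelicGroupData.gl n K).rightRegular μ))
      {β : GL (Fin n) (mixedEmbedding.mixedSpace K) → ℝ} {𝔫 𝔫' : Ideal (𝓞 K)},
      Continuous (archLevelWeight (finitePrincipalCongruenceLevel n K 𝔫) β) →
      HasCompactSupport (archLevelWeight (finitePrincipalCongruenceLevel n K 𝔫) β) →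
      ∀ (f : W.toSubmodule), (∀ g ∈ principalCongruenceLevel n K 𝔫', W.toContRep g f = f) →
      ∀ (ν : Measure ↥(adelicUnipotent n K)) (𝓕 : Set ↥(adelicUnipotent n K))
        (ψ : AddChar (AdeleRing (𝓞 K) K) Circle) {u : GL (Fin n) (FiniteAdeleRing (𝓞 K) K)},
      u ∈ finitePrincipalCongruenceLevel n K 𝔫' →
      ∀ y : GL (Fin n) (AdeleRing (𝓞 K) K),
      whittakerCoeff ν 𝓕 ψ (invQuot (AdelicGroupData.gl n K)
          (smoothedForm (archLevelWeight (finitePrincipalCongruenceLevel n K 𝔫) β) (f : (AdelicGroupData.gl n K).L2 μ)))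
          (y * GLn.ofFinite n K u) =
        whittakerCoeff ν 𝓕 ψ (invQuot (AdelicGroupData.gl n K)
          (smoothedForm (archLevelWeight (finitePrincipalCongruenceLevel n K 𝔫) β) (f : (AdelicGroupData.gl n K).L2 μ))) y := by
  intro n K _ _ μ _ W β 𝔫 𝔫' hηc hηs f hfix ν 𝓕 ψ u hu y
  exact whittakerCoeff_smoothedForm_mul_of_mem_principalCongruenceLevel W hηc hηs
    (fun k hk x => archLevelWeight_conj_eq_of_mem_glIntegralLevel 𝔫 β hk x) f hfix ν 𝓕 ψ
    (mem_finitePrincipalCongruenceLevel_iff.1 hu) y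

/-- **The pure tensor weight: right `ι_v(K_v(𝔭_v^{ord_v 𝔫'}))`-invariance at a finite place.** For
`η = β ⊗ 𝟙_{K_f(𝔫)}` continuous with compact support, `𝔫' ≠ 0`, `f' ∈ Π'` fixed by `K(𝔫')`, a finite
place `v` and `κ ∈ GL_n(K_v)` in the valued congruence subgroup of radius `|𝔫'|_v`
(`ι_v(κ) ∈ K(𝔫')`, `ofLocal_mem_principalCongruenceLevel_of_mem_levelAt`):
`W_ψ(S_η f')(y ι_v(κ)) = W_ψ(S_η f')(y)`. [folklore] -/
theorem whittakerCoeff_smoothedForm_archLevelWeight_mul_ofLocal :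
    ∀ {n : ℕ} {K : Type} [Field K] [NumberField K]
      {μ : Measure (AdelicGroupData.gl n K).automorphicQuotient} [(AdelicGroupData.gl n K).IsAutomorphicMeasure μ]
      (W : ContRepresentation.ClosedSubrep ((AdelicGroupData.gl n K).rightRegular μ))
      {β : GL (Fin n) (mixedEmbedding.mixedSpace K) → ℝ} {𝔫 𝔫' : Ideal (𝓞 K)}, 𝔫' ≠ 0 →
      Continuous (archLevelWeight (finitePrincipalCongruenceLevel n K 𝔫) β) →
      HasCompactSupport (archLevelWeight (finitePrincipalCongruenceLevel n K 𝔫) β) →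
      ∀ (f : W.toSubmodule), (∀ g ∈ principalCongruenceLevel n K 𝔫', W.toContRep g f = f) →
      ∀ (ν : Measure ↥(adelicUnipotent n K)) (𝓕 : Set ↥(adelicUnipotent n K))
        (ψ : AddChar (AdeleRing (𝓞 K) K) Circle) (v : HeightOneSpectrum (𝓞 K)) {κ : GL (Fin n) (v.adicCompletion K)},
      κ ∈ valuedCongruenceSubgroup (Fin n) (idealRadius K v 𝔫') →
      ∀ y : GL (Fin n) (AdeleRing (𝓞 K) K),
      whittakerCoeff ν 𝓕 ψ (invQuot (AdelicGroupData.gl n K)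
          (smoothedForm (archLevelWeight (finitePrincipalCongruenceLevel n K 𝔫) β) (f : (AdelicGroupData.gl n K).L2 μ)))
          (y * GLn.ofLocal n K v κ) =
        whittakerCoeff ν 𝓕 ψ (invQuot (AdelicGroupData.gl n K)
          (smoothedForm (archLevelWeight (finitePrincipalCongruenceLevel n K 𝔫) β) (f : (AdelicGroupData.gl n K).L2 μ))) y := by
  intro n K _ _ μ _ W β 𝔫 𝔫' h𝔫' hηc hηs f hfix ν 𝓕 ψ v κ hκ y
  exact whittakerCoeff_smoothedForm_mul_of_mem_principalCongruenceLevel W hηc hηs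
    (fun k hk x => archLevelWeight_conj_eq_of_mem_glIntegralLevel 𝔫 β hk x) f hfix ν 𝓕 ψ
    (ofLocal_mem_principalCongruenceLevel_of_mem_levelAt v h𝔫' hκ) y

/-- **The smoothed vector of the partner is `K(𝔫')`-fixed** (vector form, pure tensor weight): for
`η = β ⊗ 𝟙_{K_f(𝔫)}` continuous with compact support and `f' ∈ Π'` fixed by `K(𝔫')`, `S_η f'` is
fixed by `K(𝔫')`. [folklore] -/
theorem toContRep_smoothedVector_archLevelWeight_eq_self :
    ∀ {n : ℕ} {K : Type} [Field K] [NumberField K]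
      {μ : Measure (AdelicGroupData.gl n K).automorphicQuotient} [(AdelicGroupData.gl n K).IsAutomorphicMeasure μ]
      (W : ContRepresentation.ClosedSubrep ((AdelicGroupData.gl n K).rightRegular μ))
      {β : GL (Fin n) (mixedEmbedding.mixedSpace K) → ℝ} {𝔫 𝔫' : Ideal (𝓞 K)},
      Continuous (archLevelWeight (finitePrincipalCongruenceLevel n K 𝔫) β) →
      HasCompactSupport (archLevelWeight (finitePrincipalCongruenceLevel n K 𝔫) β) →
      ∀ (f : W.toSubmodule), (∀ g ∈ principalCongruenceLevel n K 𝔫', W.toContRep g f = f) →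
      ∀ g ∈ principalCongruenceLevel n K 𝔫',
      W.toContRep g (smoothedVector W (archLevelWeight (finitePrincipalCongruenceLevel n K 𝔫) β) f) =
        smoothedVector W (archLevelWeight (finitePrincipalCongruenceLevel n K 𝔫) β) f := by
  intro n K _ _ μ _ W β 𝔫 𝔫' hηc hηs f hfix g hg
  exact toContRep_smoothedVector_eq_self_of_mem_principalCongruenceLevel W hηc hηs
    (fun k hk x => archLevelWeight_conj_eq_of_mem_glIntegralLevel 𝔫 β hk x) hfix hg

end Level

end Summit.Langlands.Langlands.Theorems.ThinLastRowTorusPoint
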